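import Literature.Geometry.Riemannian.GromovW1Distance
import Mathlib.Topology.MetricSpace.Gluing
import HarnessLib

/-!
# `d_{GW₁}` between finite models with close distance matrices and weights (Bamler 2023, §2.5,
# proof of the compactness Theorem)

R. Bamler, *Compactness theory of the space of super Ricci flows*, Invent. Math. 233 (2023), §2.5,
proof of the Theorem (`(𝕄_r(V, b), d_{GW₁})` is compact): total boundedness is reduced, by the
finite-approximation Lemma, to finite metric measure spaces `(X', d|_{X'}, μ')` with `#X' ≤ N`,
`diam ≤ N r` and masses in `N⁻¹ ℤ`, of which *"there are only finitely many … up to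
`α`-closeness"*. We prove the quantitative statement behind "up to `α`-closeness": two finite
models `x : F → X`, `x' : F → X'` on a common index set whose distance matrices differ by `≤ 2η`
and whose weights `w, w'` differ by `R = Σ_p (w_p − w'_p)₊` satisfy
`d_{GW₁}(x_* w, x'_* w') ≤ η + D R` (`D` a bound for the distances of `x'`). The common metric
space is Mathlib's approximate gluing `Metric.glueMetricApprox` of `X ⊔ X'` (corresponding points
at distance `η`); the coupling is the common part `min(w, w')` on the diagonal plus the normalised
product of the excesses.

* `isCoupling_diag_add_prod`, `lintegral_diag_add_prod_le` — the coupling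
  `Δ_* γ + R⁻¹ (α₁ ⊗ β₁)` of `γ + α₁`, `γ + β₁` and its cost;
* `gromovW1_map_map_le_of_abs_dist_sub_dist_le` — **the estimate between finite models**.

Everything is proved; no definitions, no named facts.

## References

* R. H. Bamler, *Compactness theory of the space of super Ricci flows*, Invent. Math. 233 (2023),
  §2.5, proof of the Theorem ((𝕄_r(V, b), d_{GW₁}) is compact). [Bamler2023]
-/

noncomputable section

open Set MeasureTheory Filter Topology Metric Function
open scoped ENNReal NNReal

namespace Literature.Geometry.Riemannian

universe u

/-! ### The common-part coupling -/

section CommonPart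

variable {Y : Type*} [MeasurableSpace Y]

/-- In `[0, ∞]`: `R⁻¹ (R c) = c` for `0 < R < ∞`, and also for `R = 0` provided `c = 0` then.
[folklore] -/
theorem ENNReal.inv_mul_mul_left_eq_self {R c : ℝ≥0∞} (h0 : R = 0 → c = 0) (hR : R ≠ ∞) :
    R⁻¹ * (R * c) = c := by
  rcases eq_or_ne R 0 with h | h
  · rw [h0 h, mul_zero, mul_zero]
  · rw [← mul_assoc, ENNReal.inv_mul_cancel h hR, one_mul]

/-- **The common-part coupling**: if `μ = γ + α₁`, `ν = γ + β₁` with `α₁(Y) = β₁(Y) =: R < ∞`, then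
`Δ_* γ + R⁻¹ (α₁ ⊗ β₁)` (`Δ` the diagonal) is a coupling of the probability measures `μ, ν`.
[folklore] -/
theorem isCoupling_diag_add_prod {μ ν γ α₁ β₁ : Measure Y} [IsProbabilityMeasure μ]
    [IsFiniteMeasure α₁] [IsFiniteMeasure β₁] (hμ : μ = γ + α₁) (hν : ν = γ + β₁)
    (hR : α₁ univ = β₁ univ) :
    IsCoupling μ ν (γ.map (fun y ↦ (y, y)) + (α₁ univ)⁻¹ • α₁.prod β₁) := by
  have hdiag : Measurable fun y : Y ↦ (y, y) := measurable_id.prodMk measurable_id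
  have hRtop : α₁ univ ≠ ∞ := measure_ne_top _ _
  have hfst : (γ.map (fun y ↦ (y, y)) + (α₁ univ)⁻¹ • α₁.prod β₁).fst = μ := by
    simp only [Measure.fst, Measure.map_add _ _ measurable_fst, Measure.map_smul,
      Measure.map_fst_prod, Measure.map_map measurable_fst hdiag]
    rw [hμ, ← hR, smul_smul]
    congr 1
    · exact Measure.map_id
    · rcases eq_or_ne (α₁ univ) 0 with h0 | h0
      · rw [Measure.measure_univ_eq_zero.1 h0, smul_zero]
      · rw [ENNReal.inv_mul_cancel h0 hRtop, one_smul]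
  have hsnd : (γ.map (fun y ↦ (y, y)) + (α₁ univ)⁻¹ • α₁.prod β₁).snd = ν := by
    simp only [Measure.snd, Measure.map_add _ _ measurable_snd, Measure.map_smul,
      Measure.map_snd_prod, Measure.map_map measurable_snd hdiag]
    rw [hν, smul_smul]
    congr 1
    · exact Measure.map_id
    · rcases eq_or_ne (α₁ univ) 0 with h0 | h0
      · have hβ : β₁ = 0 := Measure.measure_univ_eq_zero.1 (hR ▸ h0)
        rw [hβ, smul_zero]
      · rw [ENNReal.inv_mul_cancel h0 hRtop, one_smul]
  refine ⟨⟨?_⟩, hfst, hsnd⟩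
  rw [← Measure.fst_univ, hfst, measure_univ]

/-- **Cost of the common-part coupling**: for a measurable cost `c ≤ C`,
`∫ c d(Δ_* γ + R⁻¹ α₁ ⊗ β₁) ≤ ∫ c(y, y) dγ(y) + C R`. [folklore] -/
theorem lintegral_diag_add_prod_le {γ α₁ β₁ : Measure Y} [IsFiniteMeasure α₁] [SFinite β₁]
    (hR : α₁ univ = β₁ univ) {c : Y × Y → ℝ≥0∞} (hc : Measurable c) {C : ℝ≥0∞}
    (hC : ∀ y y', c (y, y') ≤ C) :
    ∫⁻ p, c p ∂(γ.map (fun y ↦ (y, y)) + (α₁ univ)⁻¹ • α₁.prod β₁) ≤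
      ∫⁻ y, c (y, y) ∂γ + C * α₁ univ := by
  have hdiag : Measurable fun y : Y ↦ (y, y) := measurable_id.prodMk measurable_id
  rw [lintegral_add_measure, lintegral_smul_measure, lintegral_map hc hdiag]
  refine add_le_add le_rfl ?_
  calc (α₁ univ)⁻¹ * ∫⁻ p, c p ∂(α₁.prod β₁)
      ≤ (α₁ univ)⁻¹ * ∫⁻ _, C ∂(α₁.prod β₁) := by
        gcongr
        exact hC _ _
    _ = (α₁ univ)⁻¹ * (α₁ univ * (C * α₁ univ)) := by
        rw [lintegral_const, ← univ_prod_univ, Measure.prod_prod, ← hR]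
        ring_nf
    _ = C * α₁ univ :=
        ENNReal.inv_mul_mul_left_eq_self (fun h ↦ by rw [h, mul_zero]) (measure_ne_top _ _)

end CommonPart

/-! ### Finite models -/

section Discrete

variable {F : Type*} [Fintype F] [MeasurableSpace F] [MeasurableSingletonClass F]

omit [MeasurableSingletonClass F] in
/-- Mass of a finite combination of Dirac measures. [folklore] -/
theorem sum_smul_dirac_univ (c : F → ℝ≥0∞) :
    (Measure.sum fun p ↦ c p • Measure.dirac p) univ = ∑ p, c p := by
  rw [Measure.sum_apply _ MeasurableSet.univ, tsum_fintype]
  refine Finset.sum_congr rfl fun p _ ↦ ?_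
  rw [Measure.smul_apply, measure_univ, smul_eq_mul, mul_one]

/-- Integral against a finite combination of Dirac measures. [folklore] -/
theorem lintegral_sum_smul_dirac (c : F → ℝ≥0∞) (g : F → ℝ≥0∞) :
    ∫⁻ p, g p ∂(Measure.sum fun p ↦ c p • Measure.dirac p) = ∑ p, c p * g p := by
  rw [lintegral_sum_measure, tsum_fintype]
  refine Finset.sum_congr rfl fun p _ ↦ ?_
  rw [lintegral_smul_measure, lintegral_dirac, smul_eq_mul]

omit [MeasurableSpace F] [MeasurableSingletonClass F] in
/-- `Σ_p (w_p − w'_p)₊ = Σ_p (w'_p − w_p)₊` for two families with the same finite total.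
[folklore] -/
theorem sum_tsub_eq_sum_tsub {w w' : F → ℝ≥0∞} (h : ∑ p, w p = ∑ p, w' p)
    (hfin : ∑ p, w p ≠ ∞) : ∑ p, (w p - w' p) = ∑ p, (w' p - w p) := by
  have h1 : ∑ p, (w p - w' p) + ∑ p, min (w p) (w' p) = ∑ p, w p := by
    rw [← Finset.sum_add_distrib]
    exact Finset.sum_congr rfl fun p _ ↦ tsub_add_min
  have h2 : ∑ p, (w' p - w p) + ∑ p, min (w p) (w' p) = ∑ p, w' p := by
    rw [← Finset.sum_add_distrib]
    exact Finset.sum_congr rfl fun p _ ↦ by rw [min_comm]; exact tsub_add_min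
  have hmin : ∑ p, min (w p) (w' p) ≠ ∞ :=
    ne_top_of_le_ne_top hfin (Finset.sum_le_sum fun p _ ↦ min_le_left _ _)
  rw [← h, ← h1] at h2
  exact ((ENNReal.add_left_inj hmin).1 h2).symm

end Discrete

/-- **`d_{GW₁}` between finite models** (the quantitative form of *"there are only finitely many
such isometry classes up to `α`-closeness"*, Bamler 2023, §2.5, proof of the compactness
Theorem): for weights `w, w' ∈ 𝒫(F)` on a finite index set and points `x : F → X`, `x' : F → X'`
with `|d(x_p, x_q) − d'(x'_p, x'_q)| ≤ 2η` and `d'(x'_p, x'_q) ≤ D`,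
`d_{GW₁}(x_* w, x'_* w') ≤ η + D · Σ_p (w_p − w'_p)₊` — glue `X ⊔ X'` with corresponding points at
distance `η` (`Metric.glueMetricApprox`) and couple the common part of the weights diagonally.
[cite: Bamler2023, §2.5, proof of the Theorem ((𝕄_r(V, b), d_{GW₁}) is compact)] -/
theorem gromovW1_map_map_le_of_abs_dist_sub_dist_le {X X' : Type u} [MetricSpace X]
    [MeasurableSpace X] [BorelSpace X] [MetricSpace X'] [MeasurableSpace X'] [BorelSpace X']
    {F : Type*} [Fintype F] [MeasurableSpace F] [MeasurableSingletonClass F] [Nonempty F]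
    (w w' : Measure F) [IsProbabilityMeasure w] [IsProbabilityMeasure w'] (x : F → X)
    (x' : F → X') {η D : ℝ} (hη : 0 < η)
    (H : ∀ p q, |dist (x p) (x q) - dist (x' p) (x' q)| ≤ 2 * η)
    (hDx' : ∀ p q, dist (x' p) (x' q) ≤ D) :
    gromovW1 (w.map x) (w'.map x') ≤
      ENNReal.ofReal η + ENNReal.ofReal D * ∑ p, (w {p} - w' {p}) := by
  classical
  -- the glued space `X ⊔ X'`
  letI : MetricSpace (X ⊕ X') := glueMetricApprox x x' η hη H
  letI : MeasurableSpace (X ⊕ X') := borel _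
  haveI : BorelSpace (X ⊕ X') := ⟨rfl⟩
  have hinl : Isometry (Sum.inl : X → X ⊕ X') := Isometry.of_dist_eq fun _ _ ↦ rfl
  have hinr : Isometry (Sum.inr : X' → X ⊕ X') := Isometry.of_dist_eq fun _ _ ↦ rfl
  have hglue : ∀ p, edist (Sum.inl (x p) : X ⊕ X') (Sum.inr (x' p)) = ENNReal.ofReal η := by
    intro p
    rw [edist_dist]
    exact congrArg ENNReal.ofReal (glueDist_glued_points x x' η p)
  have hmx : Measurable x := measurable_of_countable x
  have hmx' : Measurable x' := measurable_of_countable x'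
  refine (gromovW1_le_wassersteinW1_map (w.map x) (w'.map x') hinl hinr).trans ?_
  rw [Measure.map_map hinl.continuous.measurable hmx,
    Measure.map_map hinr.continuous.measurable hmx']
  -- the decomposition `w = γ + α₁`, `w' = γ + β₁`
  set m : F → ℝ≥0∞ := fun p ↦ min (w {p}) (w' {p}) with hm
  set r : F → ℝ≥0∞ := fun p ↦ w {p} - w' {p} with hr
  set r' : F → ℝ≥0∞ := fun p ↦ w' {p} - w {p} with hr'
  set γ : Measure F := Measure.sum fun p ↦ m p • Measure.dirac p with hγ
  set α₁ : Measure F := Measure.sum fun p ↦ r p • Measure.dirac p with hα₁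
  set β₁ : Measure F := Measure.sum fun p ↦ r' p • Measure.dirac p with hβ₁
  have hw : w = γ + α₁ := by
    refine Measure.ext_of_singleton fun a ↦ ?_
    rw [Measure.add_apply, hγ, hα₁, Measure.sum_smul_dirac_singleton,
      Measure.sum_smul_dirac_singleton, hm, hr]
    dsimp only
    rw [add_comm, tsub_add_min]
  have hw' : w' = γ + β₁ := by
    refine Measure.ext_of_singleton fun a ↦ ?_
    rw [Measure.add_apply, hγ, hβ₁, Measure.sum_smul_dirac_singleton,
      Measure.sum_smul_dirac_singleton, hm, hr']
    dsimp only
    rw [add_comm, min_comm, tsub_add_min]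
  have hsumw : ∑ p, w {p} = 1 := by
    rw [sum_measure_singleton, Finset.coe_univ, measure_univ]
  have hsumw' : ∑ p, w' {p} = 1 := by
    rw [sum_measure_singleton, Finset.coe_univ, measure_univ]
  have hαu : α₁ univ = ∑ p, r p := sum_smul_dirac_univ r
  have hβu : β₁ univ = ∑ p, r' p := sum_smul_dirac_univ r'
  have hγu : γ univ = ∑ p, m p := sum_smul_dirac_univ m
  have hR : α₁ univ = β₁ univ := by
    rw [hαu, hβu, hr, hr']
    exact sum_tsub_eq_sum_tsub (hsumw.trans hsumw'.symm) (by rw [hsumw]; exact ENNReal.one_ne_top)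
  have hRle : α₁ univ ≤ 1 := by
    rw [hαu, ← hsumw]
    exact Finset.sum_le_sum fun p _ ↦ tsub_le_self
  have hγle : γ univ ≤ 1 := by
    rw [hγu, ← hsumw]
    exact Finset.sum_le_sum fun p _ ↦ min_le_left _ _
  haveI : IsFiniteMeasure α₁ := ⟨hRle.trans_lt ENNReal.one_lt_top⟩
  haveI : IsFiniteMeasure β₁ := ⟨(hR ▸ hRle).trans_lt ENNReal.one_lt_top⟩
  haveI : IsFiniteMeasure γ := ⟨hγle.trans_lt ENNReal.one_lt_top⟩
  -- the coupling on `F × F` and its push-forward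
  set qF : Measure (F × F) := γ.map (fun p ↦ (p, p)) + (α₁ univ)⁻¹ • α₁.prod β₁ with hqF
  have hcF : IsCoupling w w' qF := isCoupling_diag_add_prod hw hw' hR
  set f : F → X ⊕ X' := Sum.inl ∘ x with hf
  set g : F → X ⊕ X' := Sum.inr ∘ x' with hg
  have hfg : Measurable (Prod.map f g) := measurable_of_countable _
  have hc : IsCoupling (w.map f) (w'.map g) (qF.map (Prod.map f g)) := by
    obtain ⟨hP, h1, h2⟩ := hcF
    haveI := hP
    refine ⟨Measure.isProbabilityMeasure_map hfg.aemeasurable, ?_, ?_⟩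
    · rw [Measure.fst, Measure.map_map measurable_fst hfg, ← h1, Measure.fst,
        Measure.map_map (measurable_of_countable f) measurable_fst]
      rfl
    · rw [Measure.snd, Measure.map_map measurable_snd hfg, ← h2, Measure.snd,
        Measure.map_map (measurable_of_countable g) measurable_snd]
      rfl
  refine (wassersteinW1_le_lintegral hc).trans ((lintegral_map_le _ _).trans ?_)
  -- the cost: `d(f p, g q) ≤ η + d'(x'_p, x'_q) ≤ η + D`, `= η` on the diagonal
  have hcost : ∀ p q, edist (Prod.map f g (p, q)).1 (Prod.map f g (p, q)).2 ≤
      ENNReal.ofReal η + ENNReal.ofReal D := by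
    intro p q
    simp only [Prod.map_apply, hf, hg, comp_apply]
    calc edist (Sum.inl (x p) : X ⊕ X') (Sum.inr (x' q))
        ≤ edist (Sum.inl (x p) : X ⊕ X') (Sum.inr (x' p)) +
            edist (Sum.inr (x' p) : X ⊕ X') (Sum.inr (x' q)) := edist_triangle _ _ _
      _ = ENNReal.ofReal η + edist (x' p) (x' q) := by rw [hglue, hinr.edist_eq]
      _ ≤ ENNReal.ofReal η + ENNReal.ofReal D := by
          rw [edist_dist]
          exact add_le_add le_rfl (ENNReal.ofReal_le_ofReal (hDx' p q))
  refine (lintegral_diag_add_prod_le hR (measurable_of_countable _)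
    (fun p q ↦ hcost p q)).trans ?_
  -- diagonal part: `∫ η dγ ≤ η Σ m`, product part: `(η + D) R`; and `Σ m + R = 1`
  have hdiag : ∫⁻ p, edist (Prod.map f g (p, p)).1 (Prod.map f g (p, p)).2 ∂γ =
      ENNReal.ofReal η * γ univ := by
    have : (fun p ↦ edist (Prod.map f g (p, p)).1 (Prod.map f g (p, p)).2) =
        fun _ ↦ ENNReal.ofReal η := by
      funext p
      simp only [Prod.map_apply, hf, hg, comp_apply]
      exact hglue p
    rw [this, lintegral_const]
  rw [hdiag, add_mul, ← add_assoc, ← mul_add]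
  refine add_le_add (le_of_eq ?_) (le_of_eq (by simp only [hαu, hr]))
  calc ENNReal.ofReal η * (γ univ + α₁ univ) = ENNReal.ofReal η * 1 := by
        congr 1
        rw [hγu, hαu, ← hsumw, ← Finset.sum_add_distrib]
        exact Finset.sum_congr rfl fun p _ ↦ by
          simp only [hm, hr]
          rw [add_comm, tsub_add_min]
    _ = ENNReal.ofReal η := mul_one _

end Literature.Geometry.Riemannian

end
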